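import Mathlib
import HarnessLib.Audit
import Summits.PneNP.PneNP.Theorems.PstarGateRegime
import Summits.PneNP.PneNP.Theorems.PstarChordBridgeKill

/-!
# One GATED chord on bridge data: reads, the regime trichotomy, and the CASE P containments (ROUND-25, O2 / E2 step (a); prover-1 g18)

FRONTIER range-avoidance ladder, rung F-N3 (`stmt-PneNP-19007`), cell `pnp-ideate` (planner memo `r24/CORE-BOUND-NOTES.md` §14.34–14.35; this seat's
`HOME/pnp-ideate-prover-1/g18/E2-PLAN.md` §1–§3); restricted-model proof complexity — nothing here bears on `P` versus `NP`.

INSTANCE LAYER under `PstarGateDirection` / `PstarGateRegime`.  Bridge data `B` (`PstarChordBridge`) for a terminal pair whose pendant monomials avoid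
every chord private EXCEPT the first private `p = vars e 2` of ONE chord `e ∈ N`, which the FIRST constraint may read through gates `(p, u)` (and
linearly), while the second constraint does not touch `p` and nobody touches the mate `p' = vars e 3` (the E2 = blind-cotree-partner configuration after
the fibre lemma; also several gates on the same private).  Then:

* `const_of_others` — every chord `e' ≠ e` has CONSTANT read vectors (`coef_of_unread` on its two privates, which are not `p`);
* `gate_reads` — `ρ'_e ≡ 0` and `(ρ_e a).2 = 0`: the gated chord is read only by the first constraint, only through `p`, with the affine
  coefficient `ℓ(a) = coef I C₁ G₁ p a`;
* `regime_trichotomy` — **(D) of the plan**: with `(T3)`, `(M0)` on the chords and `(r,3/2)`-expansion (pairwise killability,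
  `PstarChordBridgeKill.killable_pair`): EITHER at most one other chord, OR a direction `m ≠ 0` carries every read of every other chord and every other
  chord is read (`PstarGateDirection.direction_of_others` + M-read); and `m = (1,0)` (CASE P: the whole system is single-read pointwise) or
  `m ∈ {(0,1), (1,1)}` (CASE T);
* `caseP_forced` — **(P1) of the plan**: in CASE P every other chord is ON on all of `Z(q)`, `q = q_{(1,0)} = F₂ + t₂`, and the gated chord is ON
  on `Z(q) ∩ {ℓ ≠ 0}` — `PstarChordBridgePointwise.forced_of_read_dir`, whose pointwise hypothesis the gate satisfies.

Gate on the second slot (`vars e 3`) is symmetric and not spelled out; CASE T's instance containments (normal form `toX m`, the gate then reading the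
second coordinate) follow from the mirror images of `PstarGateRegime` and are the next file.
-/

set_option linter.dupNamespace false -- `Summit.PneNP.PneNP.…`: summit = sub-problem name (D-0017 single-conjunct layout)

open Finset Literature.Computability.Complexity
open Summit.PneNP.PneNP.Theorems.PstarTyped (Typed)
open Summit.PneNP.PneNP.Theorems.PstarSALevel (varSet bdry BoundaryExpanding SimpleOverlap)
open Summit.PneNP.PneNP.Theorems.PstarProductRank (qform)
open Summit.PneNP.PneNP.Theorems.PstarReadSumset (V2)
open Summit.PneNP.PneNP.Theorems.PstarChordSystem (ChordSystem)
open Summit.PneNP.PneNP.Theorems.PstarChordBridgeTools (privs mem_privs vars_mem_privs chord_eq_of_vars_eq coef)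
open Summit.PneNP.PneNP.Theorems.PstarChordBridge (BridgeData sys sys_ρ sys_ρ' sys_ρ_of_not_mem Solution Lift infeasible_of_not_solution
  chordMinimal_of_solution_erase)
open Summit.PneNP.PneNP.Theorems.PstarChordBridgeForcing (gam coef_of_unread)
open Summit.PneNP.PneNP.Theorems.PstarChordBridgeBasis (qDir)
open Summit.PneNP.PneNP.Theorems.PstarChordBridgePointwise (forced_of_read_dir)
open Summit.PneNP.PneNP.Theorems.PstarChordBridgeKill (killable_pair)
open Summit.PneNP.PneNP.Theorems.PstarGateDirection (direction_of_others read_eq_of_U1)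

namespace Summit.PneNP.PneNP.Theorems.PstarGateBridge

variable {n m : ℕ}

/-! ## The gate hypotheses on bridge data -/

/-- **One gated chord (first slot).**  Every private of every chord is untouched by the pendant monomials of both constraints, except the first
private `p = vars e 2` of the chord `e`, which only the FIRST constraint's monomials may touch; the second constraint does not read `p` linearly;
the mate `p' = vars e 3` is read by nobody. -/
def GateHyp (I : LocalMap 4 n m) (B : BridgeData n m) (e : Fin m) : Prop :=
  e ∈ B.N ∧
  (∀ v ∈ privs I B.N, v ≠ I.vars e 2 → (∀ g ∈ B.G₁, I.vars g 2 ≠ v ∧ I.vars g 3 ≠ v) ∧ ∀ g ∈ B.G₂, I.vars g 2 ≠ v ∧ I.vars g 3 ≠ v) ∧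
  (∀ g ∈ B.G₂, I.vars g 2 ≠ I.vars e 2 ∧ I.vars g 3 ≠ I.vars e 2) ∧ I.vars e 2 ∉ B.C₂ ∧
  I.vars e 3 ∉ B.C₁ ∧ I.vars e 3 ∉ B.C₂

/-! ## Reads -/

/-- A private of another chord is not the gated private. -/
theorem priv_ne_of_ne (I : LocalMap 4 n m) {B : BridgeData n m} (hW : B.WF I) {e e' : Fin m} (he : e ∈ B.N) (he' : e' ∈ B.N) (hne : e' ≠ e)
    {s : Fin 4} (hs : 2 ≤ s.val) : I.vars e' s ≠ I.vars e 2 := fun h =>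
  hne (chord_eq_of_vars_eq I hW.hN hW.hchord he' (hW.hN he) hs h).symm

/-- **The other chords have constant read vectors.** -/
theorem const_of_others (I : LocalMap 4 n m) {B : BridgeData n m} (hW : B.WF I) {e : Fin m} (hG : GateHyp I B e) :
    ∀ e' ∈ B.N, e' ≠ e → ∀ a a', (sys I B).ρ e' a = (sys I B).ρ e' a' ∧ (sys I B).ρ' e' a = (sys I B).ρ' e' a' := by
  intro e' he' hne a a'
  obtain ⟨he, hun, -⟩ := hG
  have h2 := hun _ (vars_mem_privs I he' (s := 2) (by decide)) (priv_ne_of_ne I hW he he' hne (s := 2) (by decide))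
  have h3 := hun _ (vars_mem_privs I he' (s := 3) (by decide)) (priv_ne_of_ne I hW he he' hne (s := 3) (by decide))
  rw [sys_ρ I B he', sys_ρ' I B he', sys_ρ I B he', sys_ρ' I B he', coef_of_unread I h2.1, coef_of_unread I h2.2, coef_of_unread I h3.1,
    coef_of_unread I h3.2, coef_of_unread I h2.1, coef_of_unread I h2.2, coef_of_unread I h3.1, coef_of_unread I h3.2]
  exact ⟨rfl, rfl⟩

/-- **The reads of the gated chord**: `ρ_e(a) = (ℓ(a), 0)` with `ℓ = coef I C₁ G₁ p`, and `ρ'_e ≡ 0`. -/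
theorem gate_reads (I : LocalMap 4 n m) (hI : I.IsPure xorAndPred) {B : BridgeData n m} {e : Fin m} (hG : GateHyp I B e) (a : Fin n → ZMod 2) :
    (sys I B).ρ e a = (coef I B.C₁ B.G₁ (I.vars e 2) a, 0) ∧ (sys I B).ρ' e a = 0 := by
  obtain ⟨he, hun, hG₂p, hC₂p, hC₁p', hC₂p'⟩ := hG
  have hp'p : I.vars e 3 ≠ I.vars e 2 := fun h => absurd (hI.2 e h) (by decide)
  have h3 := hun _ (vars_mem_privs I he (s := 3) (by decide)) hp'p
  refine ⟨?_, ?_⟩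
  · rw [sys_ρ I B he, coef_of_unread I hG₂p (C := B.C₂), if_neg hC₂p]
  · rw [sys_ρ' I B he, coef_of_unread I h3.1, coef_of_unread I h3.2, if_neg hC₁p', if_neg hC₂p']; rfl

/-- So the gated chord's reads lie pointwise on the line of `(1,0)`. -/
theorem gate_reads_line (I : LocalMap 4 n m) (hI : I.IsPure xorAndPred) {B : BridgeData n m} {e : Fin m} (hG : GateHyp I B e) (a : Fin n → ZMod 2) :
    ((sys I B).ρ e a = 0 ∨ (sys I B).ρ e a = (1, 0)) ∧ ((sys I B).ρ' e a = 0 ∨ (sys I B).ρ' e a = (1, 0)) := by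
  obtain ⟨hρ, hρ'⟩ := gate_reads I hI hG a
  refine ⟨?_, Or.inl hρ'⟩
  rw [hρ]
  have h01 : ∀ t : ZMod 2, t = 0 ∨ t = 1 := by decide
  rcases h01 (coef I B.C₁ B.G₁ (I.vars e 2) a) with h | h
  · left; rw [h]; rfl
  · right; rw [h]

/-! ## The regime trichotomy -/

/-- **(D) Regime trichotomy for one gated chord.**  Pure typed `(r,3/2)`-expanding instance with simple overlaps, well-formed liftable bridge data with
`#J₀ ≤ r`, the gate hypotheses, (T3) and (M0) on the chords.  Then: the other chords number at most one; OR every other chord is read and all their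
(constant) read vectors lie on the line of ONE `m ≠ 0`, which is `(1,0)` — CASE P: the whole model is single-read pointwise — or one of `(0,1)`,
`(1,1)` — CASE T. -/
theorem regime_trichotomy (I : LocalMap 4 n m) (hI : I.IsPure xorAndPred) (hT : Typed I) (hS : SimpleOverlap I) {r : ℕ}
    (hB : BoundaryExpanding r I) {B : BridgeData n m} (hW : B.WF I) (hr : B.J₀.card ≤ r) (hL : Lift I B) {e : Fin m} (hG : GateHyp I B e)
    (hT3 : ¬ ∃ z, Solution I B B.J₀ z) (hM0 : ∀ f ∈ B.N, ∃ z, Solution I B (B.J₀.erase f) z) :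
    (B.N.erase e).card ≤ 1 ∨
    ∃ mv : V2, mv ≠ 0 ∧
      (∀ e' ∈ B.N, e' ≠ e → ∀ a, ((sys I B).ρ e' a = 0 ∨ (sys I B).ρ e' a = mv) ∧ ((sys I B).ρ' e' a = 0 ∨ (sys I B).ρ' e' a = mv)) ∧
      (∀ e' ∈ B.N, e' ≠ e → ∀ a, (sys I B).ρ e' a ≠ 0 ∨ (sys I B).ρ' e' a ≠ 0) ∧
      (mv = (1, 0) ∨ mv = (0, 1) ∨ mv = (1, 1)) := by
  classical
  have hinf : (sys I B).Infeasible B.N := infeasible_of_not_solution I hI hT hW hL hT3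
  have hconst := const_of_others I hW hG
  -- every other chord is read (M-read), everywhere (constancy)
  have hread : ∀ e' ∈ B.N, e' ≠ e → ∀ a, (sys I B).ρ e' a ≠ 0 ∨ (sys I B).ρ' e' a ≠ 0 := by
    intro e' he' hne a
    obtain ⟨z, hz⟩ := hM0 e' he'
    obtain ⟨a₀, -, -, -, hR⟩ := (sys I B).read_of_chordMinimal hinf he' (chordMinimal_of_solution_erase I hI hT hW he' hz)
    unfold ChordSystem.Read at hR
    rw [(hconst e' he' hne a a₀).1, (hconst e' he' hne a a₀).2]
    exact hR
  -- direction collapse for the others, with `r, r'` their reads at `0`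
  have hdir := direction_of_others (sys I B) hinf e (r := fun i => (sys I B).ρ i 0) (r' := fun i => (sys I B).ρ' i 0)
    (fun i hi hie a => ⟨(hconst i hi hie a 0).1, (hconst i hi hie a 0).2⟩)
    (fun i hi j hj _ _ hij => killable_pair I hI hS hB hW hr i hi j hj hij)
  by_cases hcard : (B.N.erase e).card ≤ 1
  · exact Or.inl hcard
  right
  -- two distinct other chords
  obtain ⟨i, hi, j, hj, hij⟩ := one_lt_card.1 (not_le.1 hcard)
  obtain ⟨hie, hiN⟩ := mem_erase.1 hi
  obtain ⟨hje, hjN⟩ := mem_erase.1 hj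
  rcases hdir with ⟨mv, hmv⟩ | ⟨i₀, hi₀, -, -, -, hU2⟩
  · obtain ⟨hmv0, -⟩ := read_eq_of_U1 hmv hi (hread i hiN hie 0)
    refine ⟨mv, hmv0, fun e' he' hne a => ?_, hread, ?_⟩
    · rw [(hconst e' he' hne a 0).1, (hconst e' he' hne a 0).2]; exact hmv e' (mem_erase.2 ⟨hne, he'⟩)
    · obtain ⟨a, b⟩ := mv
      have h01 : ∀ t : ZMod 2, t = 0 ∨ t = 1 := by decide
      rcases h01 a with rfl | rfl <;> rcases h01 b with rfl | rfl
      · exact absurd rfl hmv0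
      · exact Or.inr (Or.inl rfl)
      · exact Or.inl rfl
      · exact Or.inr (Or.inr rfl)
  · -- (U2): only `i₀` is read among the others — but `i` and `j` are both read
    exfalso
    rcases eq_or_ne i i₀ with rfl | hii₀
    · have h := hU2 j hj (Ne.symm hij)
      rcases hread j hjN hje 0 with h' | h'
      · exact h' h.1
      · exact h' h.2
    · have h := hU2 i hi hii₀
      rcases hread i hiN hie 0 with h' | h'
      · exact h' h.1
      · exact h' h.2

/-! ## CASE P: the containments -/

/-- **(P1) CASE P.**  If the other chords read along `(1,0)` (the gate's own direction), then for every base point `x` on `Z(q)`, `q = q_{(1,0)}`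
(`= F₂ + t₂`, state-free): every other chord is ON at `x` — `Q_{D e'}(x) = γ_{e'} + 1` — and the gated chord is ON wherever its coefficient
`ℓ(x) = coef I C₁ G₁ p x` is non-zero.  (`forced_of_read_dir`: its pointwise hypothesis holds for the gate by `gate_reads_line`.) -/
theorem caseP_forced (I : LocalMap 4 n m) (hI : I.IsPure xorAndPred) (hT : Typed I) {B : BridgeData n m} (hW : B.WF I) (hL : Lift I B)
    {e : Fin m} (hG : GateHyp I B e) (hT3 : ¬ ∃ z, Solution I B B.J₀ z)
    (hP : ∀ e' ∈ B.N, e' ≠ e → ∀ a, ((sys I B).ρ e' a = 0 ∨ (sys I B).ρ e' a = (1, 0)) ∧ ((sys I B).ρ' e' a = 0 ∨ (sys I B).ρ' e' a = (1, 0)))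
    (hread : ∀ e' ∈ B.N, e' ≠ e → ∀ a, (sys I B).ρ e' a ≠ 0 ∨ (sys I B).ρ' e' a ≠ 0)
    {x : Fin n → ZMod 2} (hZ : qDir I B (1, 0) x = 0) :
    (∀ e' ∈ B.N, e' ≠ e → qform (B.D e') (fun j => I.vars j 2) (fun j => I.vars j 3) x = gam B e' + 1) ∧
    (coef I B.C₁ B.G₁ (I.vars e 2) x ≠ 0 → qform (B.D e) (fun j => I.vars j 2) (fun j => I.vars j 3) x = gam B e + 1) := by
  classical
  have hinf : (sys I B).Infeasible B.N := infeasible_of_not_solution I hI hT hW hL hT3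
  have h10 : ((1, 0) : V2) ≠ 0 := by decide
  -- the pointwise line hypothesis for ALL chords
  have hU1 : ∀ i a, ((sys I B).ρ i a = 0 ∨ (sys I B).ρ i a = (1, 0)) ∧ ((sys I B).ρ' i a = 0 ∨ (sys I B).ρ' i a = (1, 0)) := by
    intro i a
    by_cases hi : i ∈ B.N
    · by_cases hie : i = e
      · subst hie; exact gate_reads_line I hI hG a
      · exact hP i hi hie a
    · rw [(sys_ρ_of_not_mem I B hi a).1, (sys_ρ_of_not_mem I B hi a).2]; exact ⟨Or.inl rfl, Or.inl rfl⟩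
  refine ⟨fun e' he' hne => forced_of_read_dir I B hinf h10 hU1 he' hZ (hread e' he' hne x), fun hl => ?_⟩
  refine forced_of_read_dir I B hinf h10 hU1 hG.1 hZ (Or.inl ?_)
  rw [(gate_reads I hI hG x).1]
  exact fun h => hl (congrArg Prod.fst h)

/-- **(P1′) CASE P, the first coordinate on `Z(q)`**: at a point of `Z(q)` the first target coordinate is unreachable, so the state-free part plus the
forced reads misses it by one (`PstarGateRegime.fst_eq_of_unreach_fst`) — the identity "`R + ℓ ≡ ¬t₁` on `Z`" once the forced set is known. -/
theorem caseP_fst (I : LocalMap 4 n m) (hI : I.IsPure xorAndPred) (hT : Typed I) {B : BridgeData n m} (hW : B.WF I) (hL : Lift I B)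
    {e : Fin m} (hG : GateHyp I B e) (hT3 : ¬ ∃ z, Solution I B B.J₀ z)
    (hP : ∀ e' ∈ B.N, e' ≠ e → ∀ a, ((sys I B).ρ e' a = 0 ∨ (sys I B).ρ e' a = (1, 0)) ∧ ((sys I B).ρ' e' a = 0 ∨ (sys I B).ρ' e' a = (1, 0)))
    {x : Fin n → ZMod 2} (hZ : qDir I B (1, 0) x = 0) :
    ((sys I B).F x).1 + ∑ i ∈ B.N.filter (fun i => ¬ (sys I B).u i x = 0), ((sys I B).ρ i x + (sys I B).ρ' i x).1 = (sys I B).t.1 + 1 := by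
  classical
  have hinf : (sys I B).Infeasible B.N := infeasible_of_not_solution I hI hT hW hL hT3
  -- single-read at `x`
  have hS : ∀ i ∈ B.N, ((sys I B).ρ i x).2 = 0 ∧ ((sys I B).ρ' i x).2 = 0 := by
    intro i hi
    by_cases hie : i = e
    · subst hie
      obtain ⟨hρ, hρ'⟩ := gate_reads I hI hG x
      rw [hρ, hρ']; exact ⟨rfl, rfl⟩
    · obtain ⟨h1, h2⟩ := hP i hi hie x
      refine ⟨?_, ?_⟩
      · rcases h1 with h | h
        · rw [h]; rfl
        · rw [h]
      · rcases h2 with h | h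
        · rw [h]; rfl
        · rw [h]
  -- `Z(q)`: the second coordinate of the state-free part is the target's
  have hZ' : ((sys I B).F x).2 = (sys I B).t.2 := by
    have h := PstarChordBridgeBasis.q_dir I B (1, 0) x
    rw [hZ] at h
    rw [PstarChordSystemMap.mapSys_F, PstarChordSystemMap.mapSys_t, PstarChordSystemMap.toX_snd, PstarChordSystemMap.toX_snd] at h
    simp only [mul_zero, mul_one, zero_add] at h
    have e2 : ∀ a b : ZMod 2, a + b = 0 → a = b := by decide
    exact e2 _ _ h
  exact PstarGateRegime.fst_eq_of_unreach_fst (sys I B) (PstarGateRegime.unreach_fst_of_singleRead_at (sys I B) hinf hS hZ')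

end Summit.PneNP.PneNP.Theorems.PstarGateBridge
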